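import Summits.FinalStateConjecture.FinalStateConjecture.Theorems.StarvedNecksNeckGapDecayOfCore
import HarnessLib

/-!
# Bounded excision ⇒ self-certified (crux `StarvedNecks.NeckGapDecay`, stmt-FinalStateConjecture-16768,
# line `Sketch`; `--supports`, anchor for the open stub `stub_gapCore : OfCore.GapCoreHolds`)

A proved SPECIALISATION of the one open stub of the line (continuation lead c4): the implication inside
`OfCore.GapCoreHolds` is about holes whose input chart is NOT self-certified below any normalised dominating
wall.  If the excision radius `ρᵢ` of hole `i` is eventually bounded, `ρᵢ(s) ≤ C` for `s ≥ T₀`, then the CONSTANT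
wall `W ≡ max (R₀ + 2) (3C + 2)` is normalised (continuous, monotone, sublinear, slope clause, `≥ R₀ + 2`) and
dominating, and its sub-wall slabs `{tᵢ = τ, rᵢ ≤ W}` are truncated slabs of FIXED radius, on which the `C⁴` (hence
`C²`) deviation of the input chart tends to `0` by the decomposition's own near-zone convergence
`FinalStateDecomposition.tendsto_truncDeviationCk`.  So such a hole IS self-certified
(`selfCertified_of_excision_le`) and the `GapCoreHolds` clause for it holds vacuously
(`gapCoreClause_of_excision_le`): the open physics concerns exactly the holes with unbounded excision radius.
Over an arbitrary spacetime (no MGHD binding is used).  References: DHRT arXiv:2104.08222, §1 (deviation norms on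
truncated slabs).
-/

noncomputable section

open scoped Manifold ContDiff Topology ENNReal
open Filter Set Topology Literature.Geometry.Lorentzian Literature.Uncategorized

namespace Summit.FinalStateConjecture.FinalStateConjecture.Theorems.NeckGapDecay.ConnectionLevelCones.OfCore

open Summit.FinalStateConjecture.FinalStateConjecture.Theorems.NeckGapDecay.ConnectionLevelCones.CertOfCoreStub
  (GapCoreCert)

-- the problem namespace `Summit.FinalStateConjecture.FinalStateConjecture` repeats the summit name by design
set_option linter.dupNamespace false
-- instance search through nested operator types `E4 →L[ℝ] E4 →L[ℝ] ℝ`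
set_option maxSynthPendingDepth 3

/-- **Bounded excision ⇒ self-certified.**  If the excision radius of hole `i` satisfies `ρᵢ(s) ≤ C` for all
`s ≥ T₀`, then the constant wall `W ≡ max (R₀ + 2) (3C + 2)` is a normalised dominating wall below which the input
chart `Ψᵢ` is `C²`-certified: the sub-wall slab `{tᵢ = τ, rᵢ ≤ W}` is the truncated slab of radius `W`, and
`truncDeviationCk … 4 W τ → 0` is the decomposition's near-zone convergence.  DHRT arXiv:2104.08222, §1. -/
theorem selfCertified_of_excision_le (𝓢 : Spacetime.{0} 4) (O : Set 𝓢.carrier)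
    (d : FinalStateDecomposition 𝓢 O 4) (R₀ : ℝ) (i : Fin d.N) (T₀ C : ℝ)
    (hC : ∀ s, T₀ ≤ s → d.excision i s ≤ C) :
    ∃ (T₀ : ℝ) (W : ℝ → ℝ), Continuous W ∧ Monotone W ∧ Tendsto (fun s ↦ W s / s) atTop (𝓝 0) ∧
      (∀ s s', s ≤ s' →
        W s' ≤ W s + 1 / (10 * ‖(((d.motion i).1 : E4 ≃L[ℝ] E4) : E4 →L[ℝ] E4)‖ ^ 2) * (s' - s)) ∧
      (∀ s, R₀ + 2 ≤ W s) ∧ (∀ s, T₀ ≤ s → 3 * d.excision i s + 2 ≤ W s) ∧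
      Tendsto (fun τ ↦ supCkENorm (Subtype.val '' {x : (d.background i).domain |
        (d.background i).time x.1 = τ ∧ (d.background i).radius x.1 ≤ W (x.1 0)}) 2
        (𝓢.deviationExtend (d.background i) (d.chart i))) atTop (𝓝 0) := by
  set Wc : ℝ := max (R₀ + 2) (3 * C + 2) with hWc
  refine ⟨T₀, fun _ ↦ Wc, continuous_const, monotone_const, ?_, ?_, ?_, ?_, ?_⟩
  · exact tendsto_const_nhds.div_atTop tendsto_id
  · intro s s' hss'
    have hL : 0 ≤ 1 / (10 * ‖(((d.motion i).1 : E4 ≃L[ℝ] E4) : E4 →L[ℝ] E4)‖ ^ 2) := by positivity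
    nlinarith [mul_nonneg hL (sub_nonneg.mpr hss')]
  · intro s
    exact le_max_left _ _
  · intro s hs
    have h := hC s hs
    calc 3 * d.excision i s + 2 ≤ 3 * C + 2 := by linarith
      _ ≤ Wc := le_max_right _ _
  · have h4 := d.tendsto_truncDeviationCk i Wc
    refine tendsto_of_tendsto_of_tendsto_of_le_of_le tendsto_const_nhds h4 (fun _ ↦ bot_le) fun τ ↦ ?_
    change supCkENorm _ 2 _ ≤
      supCkENorm (Subtype.val '' (d.background i).truncTimeSlab Wc τ) 4
        (𝓢.deviationExtend (d.background i) (d.chart i))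
    exact supCkENorm_mono_right _ (by norm_num) _

/-- **The `GapCoreHolds` clause holds vacuously for holes with eventually bounded excision radius**: such a hole is
self-certified (`selfCertified_of_excision_le`), contradicting the clause's hypothesis.  A proved specialisation of the
open stub `stub_gapCore : OfCore.GapCoreHolds` of the line `Sketch` — the open content concerns exactly the holes with
unbounded `ρᵢ`.  DHRT arXiv:2104.08222, §1. -/
theorem gapCoreClause_of_excision_le (𝓢 : Spacetime.{0} 4) (O : Set 𝓢.carrier)
    (d : FinalStateDecomposition 𝓢 O 4) (R₀ : ℝ) (i : Fin d.N) (T₀ C : ℝ)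
    (hC : ∀ s, T₀ ≤ s → d.excision i s ≤ C)
    (hnot : ¬ (∃ (T₀ : ℝ) (W : ℝ → ℝ), Continuous W ∧ Monotone W ∧ Tendsto (fun s ↦ W s / s) atTop (𝓝 0) ∧
      (∀ s s', s ≤ s' →
        W s' ≤ W s + 1 / (10 * ‖(((d.motion i).1 : E4 ≃L[ℝ] E4) : E4 →L[ℝ] E4)‖ ^ 2) * (s' - s)) ∧
      (∀ s, R₀ + 2 ≤ W s) ∧ (∀ s, T₀ ≤ s → 3 * d.excision i s + 2 ≤ W s) ∧
      Tendsto (fun τ ↦ supCkENorm (Subtype.val '' {x : (d.background i).domain |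
        (d.background i).time x.1 = τ ∧ (d.background i).radius x.1 ≤ W (x.1 0)}) 2
        (𝓢.deviationExtend (d.background i) (d.chart i))) atTop (𝓝 0))) :
    ∃ (T₀ : ℝ) (W : ℝ → ℝ), Continuous W ∧ Monotone W ∧ Tendsto (fun s ↦ W s / s) atTop (𝓝 0) ∧
      (∀ s s', s ≤ s' →
        W s' ≤ W s + 1 / (10 * ‖(((d.motion i).1 : E4 ≃L[ℝ] E4) : E4 →L[ℝ] E4)‖ ^ 2) * (s' - s)) ∧
      (∀ s, R₀ + 2 ≤ W s) ∧ (∀ s, T₀ ≤ s → 3 * d.excision i s + 2 ≤ W s) ∧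
      GapCoreCert 𝓢 O d R₀ i T₀ W :=
  (hnot (selfCertified_of_excision_le 𝓢 O d R₀ i T₀ C hC)).elim

end Summit.FinalStateConjecture.FinalStateConjecture.Theorems.NeckGapDecay.ConnectionLevelCones.OfCore

end
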